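import Mathlib
import Literature.AlgebraicGeometry.Resolution.PlaneGermBlowup
import Literature.AlgebraicGeometry.Resolution.PlaneGermNonNCCount

/-!
# `WeightedInvariant.LocalWeightedDrop`, line `hasse-ridge-face-selection`: assembling the non-NC count

Crux item stmt-ResolutionOfSingularities-8899 (route `ResolutionOfSingularities/WeightedInvariant`),
skeleton v12 of the line `hasse-ridge-face-selection`, stub `stub_nonNCCountAssembly` (GLUE), PROVED here
(statement verbatim from the ledger registration).

**Statement.**  Over a field `k`, assume
* TOOLKIT (the folklore calculus of first-neighbourhood germs of plane curve germs `b ∈ k[[x, y]]`):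
  every non-zero germ has a reduced total transform germ at every point of the first neighbourhood
  (finite slope `t` or vertical); transforms in a fixed chart are unique; successors are non-zero; all
  but finitely many slopes give a transform with normal-crossing support; transforms lift along
  divisibility `b ∣ d`; normal-crossing support descends along divisibility;
* SCALING (the action of the rescalings `g ↦ μ · g(αx, βy)`): in particular its equivariance on
  transforms, its compatibility with normal crossings and with vanishing, and the identification of the
  literal weight-`(1,1)` cobordant chart followed by a coordinate slice with a rescaled successor germ;
* NOCHAIN (the theorem): there is no infinite chain of bad steps `b₀ → b₁ → ⋯` (a bad step `b → D`:
  `b ≠ 0`, the support of `b` is not a normal crossing, `D` a first-neighbourhood germ of `b`).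
Then `PlaneGermNonNCCount k` holds: there is `ν : k[[x, y]] → ℕ` with (i) for `b ≠ 0`, `ν b = 0` iff the
support of `b` is a normal crossing, (ii) `b ∣ d ≠ 0 → ν b ≤ ν d`, (iii) strict drop of `ν` at every
exceptional point of the first blow-up of a non-normal-crossing germ.

**Proof.**  `ν b :=` the length of the longest chain of bad steps starting at `b`.  To avoid
introducing definitions, the chain-length predicate `H n b` ("some chain of `n` bad steps starts at `b`")
is handled abstractly through its two defining clauses and instantiated by `Nat.rec` only inside the final
proof.  NOCHAIN makes the bad-step relation well-founded (`wellFounded_iff_isEmpty_descending_chain`);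
well-founded induction plus TOOLKIT (finitely many non-normal-crossing successors up to the uniqueness of
transforms, and no bad step out of a normal-crossing germ) bounds the chain lengths from every germ, so
`ν b = sSup {n | H n b}` is attained and bounds every chain.  (i) is immediate (a non-normal-crossing
non-zero germ has a successor, hence a bad step); (ii) chains lift along divisibility (TOOLKIT);
(iii) the slice germ is a rescaled successor `C μ * D(αx, βy)` (SCALING), chains descend from a rescaled
germ to the germ (equivariance), and a chain from the successor `D` extends by the bad step `b → D`.
-/

set_option linter.dupNamespace false -- mandated namespace of this single-conjunct summit

namespace Summit.ResolutionOfSingularities.ResolutionOfSingularities.Theorems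

open Literature.AlgebraicGeometry.Resolution

namespace NonNCCountAssembly

variable {k : Type} [Field k]

/-! ### Abstract bad chains -/

/-- A chain-length predicate exists: `H 0 b` always, and `H (n + 1) b` iff some bad step `b → D` is
followed by a chain of `n` bad steps from `D`. -/
theorem exists_chainPred : ∃ H : ℕ → MvPowerSeries (Fin 2) k → Prop,
    (∀ b, H 0 b) ∧ ∀ n b, (H (n + 1) b ↔ ∃ D, PlaneGerm.IsBadStep b D ∧ H n D) :=
  ⟨fun n => Nat.rec (motive := fun _ => MvPowerSeries (Fin 2) k → Prop) (fun _ => True)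
      (fun _ ih b => ∃ D, PlaneGerm.IsBadStep b D ∧ ih D) n,
    fun _ => trivial, fun _ _ => Iff.rfl⟩

/-- With no bad step out of `b` (i.e. `b = 0` or the support of `b` is a normal crossing), every bad
chain from `b` has length `0`. -/
theorem chain_eq_zero_of_not_bad (H : ℕ → MvPowerSeries (Fin 2) k → Prop)
    (hHs : ∀ n b, H (n + 1) b ↔ ∃ D, PlaneGerm.IsBadStep b D ∧ H n D)
    {b : MvPowerSeries (Fin 2) k} (hb : ¬ (b ≠ 0 ∧ ¬ PlaneGerm.IsNC b)) {n : ℕ} (hn : H n b) :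
    n = 0 := by
  cases n with
  | zero => rfl
  | succ n =>
    obtain ⟨D, hD, -⟩ := (hHs n b).1 hn
    exact absurd ⟨hD.1, hD.2.1⟩ hb

/-- NOCHAIN: the relation "`D` is reached from `b` by a bad step" is well-founded. -/
theorem wellFounded_badStep
    (h3 : ∀ f : ℕ → MvPowerSeries (Fin 2) k, ∃ i, ¬ PlaneGerm.IsBadStep (f i) (f (i + 1))) :
    WellFounded (fun D b : MvPowerSeries (Fin 2) k => PlaneGerm.IsBadStep b D) := by
  rw [wellFounded_iff_isEmpty_descending_chain]
  refine ⟨fun ⟨f, hf⟩ => ?_⟩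
  obtain ⟨i, hi⟩ := h3 f
  exact hi (hf i)

/-- Finiteness of the tree of bad chains below `b`: their lengths are bounded (well-founded induction
along bad steps; at each germ only the finitely many non-normal-crossing successors and the vertical one
carry chains of positive length, and transforms in a fixed chart are unique). -/
theorem chain_bounded (H : ℕ → MvPowerSeries (Fin 2) k → Prop)
    (hHs : ∀ n b, H (n + 1) b ↔ ∃ D, PlaneGerm.IsBadStep b D ∧ H n D)
    (hExist : ∀ b : MvPowerSeries (Fin 2) k, b ≠ 0 →
      (∀ t : k, ∃ D, PlaneGerm.IsTransform (PlaneGerm.dirChart t) b D) ∧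
      ∃ D, PlaneGerm.IsTransform (PlaneGerm.vertChart k) b D)
    (hUniq : ∀ (Φ : Fin 2 → MvPowerSeries (Fin 2) k) (b D D' : MvPowerSeries (Fin 2) k),
      PlaneGerm.IsTransform Φ b D → PlaneGerm.IsTransform Φ b D' → D = D')
    (hFin : ∀ b : MvPowerSeries (Fin 2) k, b ≠ 0 → ∃ T : Finset k, ∀ t ∉ T,
      ∀ D : MvPowerSeries (Fin 2) k, PlaneGerm.IsTransform (PlaneGerm.dirChart t) b D → PlaneGerm.IsNC D)
    (h3 : ∀ f : ℕ → MvPowerSeries (Fin 2) k, ∃ i, ¬ PlaneGerm.IsBadStep (f i) (f (i + 1)))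
    (b : MvPowerSeries (Fin 2) k) : ∃ B : ℕ, ∀ n, H n b → n ≤ B := by
  induction b using (wellFounded_badStep h3).induction with
  | _ b ih => ?_
  by_cases hbad : b ≠ 0 ∧ ¬ PlaneGerm.IsNC b
  · obtain ⟨hb, hnc⟩ := hbad
    obtain ⟨T, hT⟩ := hFin b hb
    choose Dt hDt using (hExist b hb).1
    obtain ⟨Dv, hDv⟩ := (hExist b hb).2
    have hbadt : ∀ t, PlaneGerm.IsBadStep b (Dt t) := fun t => ⟨hb, hnc, Or.inl ⟨t, hDt t⟩⟩
    choose Bt hBt using fun t => ih (Dt t) (hbadt t)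
    obtain ⟨Bv, hBv⟩ := ih Dv ⟨hb, hnc, Or.inr hDv⟩
    refine ⟨1 + Bv + T.sup Bt, fun n hn => ?_⟩
    cases n with
    | zero => exact Nat.zero_le _
    | succ n =>
      obtain ⟨D, hD, hnD⟩ := (hHs n b).1 hn
      rcases hD.2.2 with ⟨t, ht⟩ | hv
      · by_cases htT : t ∈ T
        · have hDeq : D = Dt t := hUniq _ b D (Dt t) ht (hDt t)
          have h1 : n ≤ Bt t := hBt t n (hDeq ▸ hnD)
          have h2 : Bt t ≤ T.sup Bt := Finset.le_sup htT
          omega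
        · have hNC : PlaneGerm.IsNC D := hT t htT D ht
          have hn0 : n = 0 := chain_eq_zero_of_not_bad H hHs (fun h => h.2 hNC) hnD
          omega
      · have hDeq : D = Dv := hUniq _ b D Dv hv hDv
        have h1 : n ≤ Bv := hBv n (hDeq ▸ hnD)
        omega
  · exact ⟨0, fun n hn => (chain_eq_zero_of_not_bad H hHs hbad hn).le⟩

omit [Field k] in
/-- The longest bad chain: a function `ν` bounding the length of every bad chain from `b`, the bound
being attained. -/
theorem exists_count (H : ℕ → MvPowerSeries (Fin 2) k → Prop) (hH0 : ∀ b, H 0 b)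
    (hbdd : ∀ b, ∃ B : ℕ, ∀ n, H n b → n ≤ B) :
    ∃ ν : MvPowerSeries (Fin 2) k → ℕ, (∀ b n, H n b → n ≤ ν b) ∧ ∀ b, H (ν b) b := by
  have hB : ∀ b, BddAbove {n : ℕ | H n b} := fun b => by
    obtain ⟨B, hB⟩ := hbdd b
    exact ⟨B, fun n hn => hB n hn⟩
  exact ⟨fun b => sSup {n : ℕ | H n b}, fun b _ hn => le_csSup (hB b) hn,
    fun b => Nat.sSup_mem ⟨0, hH0 b⟩ (hB b)⟩

/-- Bad chains lift along divisibility `b ∣ d`, `d ≠ 0` (transforms lift chart by chart, successors are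
non-zero, and normal-crossing support descends to divisors). -/
theorem chain_of_dvd (H : ℕ → MvPowerSeries (Fin 2) k → Prop) (hH0 : ∀ b, H 0 b)
    (hHs : ∀ n b, H (n + 1) b ↔ ∃ D, PlaneGerm.IsBadStep b D ∧ H n D)
    (hNe : ∀ b D : MvPowerSeries (Fin 2) k, PlaneGerm.IsSuccessor b D → D ≠ 0)
    (hDiv : ∀ b d D : MvPowerSeries (Fin 2) k, d ≠ 0 → b ∣ d →
      (∀ t : k, PlaneGerm.IsTransform (PlaneGerm.dirChart t) b D →
        ∃ D', PlaneGerm.IsTransform (PlaneGerm.dirChart t) d D' ∧ D ∣ D') ∧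
      (PlaneGerm.IsTransform (PlaneGerm.vertChart k) b D →
        ∃ D', PlaneGerm.IsTransform (PlaneGerm.vertChart k) d D' ∧ D ∣ D'))
    (hNCdown : ∀ b d : MvPowerSeries (Fin 2) k, d ≠ 0 → b ∣ d → PlaneGerm.IsNC d → PlaneGerm.IsNC b) :
    ∀ (n : ℕ) (b d : MvPowerSeries (Fin 2) k), d ≠ 0 → b ∣ d → H n b → H n d := by
  intro n
  induction n with
  | zero => exact fun _ d _ _ _ => hH0 d
  | succ n ih =>
    intro b d hd hbd hn
    obtain ⟨D, ⟨_, hnc, hsucc⟩, hnD⟩ := (hHs n b).1 hn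
    have hncd : ¬ PlaneGerm.IsNC d := fun h => hnc (hNCdown b d hd hbd h)
    rcases hsucc with ⟨t, ht⟩ | hv
    · obtain ⟨D', hD', hDD'⟩ := (hDiv b d D hd hbd).1 t ht
      exact (hHs n d).2
        ⟨D', ⟨hd, hncd, Or.inl ⟨t, hD'⟩⟩, ih D D' (hNe d D' (Or.inl ⟨t, hD'⟩)) hDD' hnD⟩
    · obtain ⟨D', hD', hDD'⟩ := (hDiv b d D hd hbd).2 hv
      exact (hHs n d).2 ⟨D', ⟨hd, hncd, Or.inr hD'⟩, ih D D' (hNe d D' (Or.inr hD')) hDD' hnD⟩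

/-- Bad chains descend from a rescaled germ `μ · g(αx, βy)` (`μ α β ≠ 0`) to `g` (equivariance of
transforms under rescalings, invariance of normal crossings and of vanishing). -/
theorem chain_of_rescaled (H : ℕ → MvPowerSeries (Fin 2) k → Prop) (hH0 : ∀ b, H 0 b)
    (hHs : ∀ n b, H (n + 1) b ↔ ∃ D, PlaneGerm.IsBadStep b D ∧ H n D)
    (hExist : ∀ b : MvPowerSeries (Fin 2) k, b ≠ 0 →
      (∀ t : k, ∃ D, PlaneGerm.IsTransform (PlaneGerm.dirChart t) b D) ∧
      ∃ D, PlaneGerm.IsTransform (PlaneGerm.vertChart k) b D)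
    (hEquiv : ∀ (μ α β : k), μ ≠ 0 → α ≠ 0 → β ≠ 0 → ∀ g : MvPowerSeries (Fin 2) k,
      (∀ t : k, ∃ t' : k, ∀ D D' : MvPowerSeries (Fin 2) k,
        PlaneGerm.IsTransform (PlaneGerm.dirChart t)
          (MvPowerSeries.C μ * MvPowerSeries.subst (PlaneGerm.diagScale α β) g) D →
        PlaneGerm.IsTransform (PlaneGerm.dirChart t') g D' →
        ∃ (μ' α' β' : k), μ' ≠ 0 ∧ α' ≠ 0 ∧ β' ≠ 0 ∧
          D = MvPowerSeries.C μ' * MvPowerSeries.subst (PlaneGerm.diagScale α' β') D') ∧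
      (∀ D D' : MvPowerSeries (Fin 2) k,
        PlaneGerm.IsTransform (PlaneGerm.vertChart k)
          (MvPowerSeries.C μ * MvPowerSeries.subst (PlaneGerm.diagScale α β) g) D →
        PlaneGerm.IsTransform (PlaneGerm.vertChart k) g D' →
        ∃ (μ' α' β' : k), μ' ≠ 0 ∧ α' ≠ 0 ∧ β' ≠ 0 ∧
          D = MvPowerSeries.C μ' * MvPowerSeries.subst (PlaneGerm.diagScale α' β') D'))
    (hInv : ∀ (μ α β : k), μ ≠ 0 → α ≠ 0 → β ≠ 0 → ∀ g : MvPowerSeries (Fin 2) k,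
      (PlaneGerm.IsNC (MvPowerSeries.C μ * MvPowerSeries.subst (PlaneGerm.diagScale α β) g) ↔
        PlaneGerm.IsNC g) ∧
      (MvPowerSeries.C μ * MvPowerSeries.subst (PlaneGerm.diagScale α β) g = 0 ↔ g = 0)) :
    ∀ (n : ℕ) (μ α β : k) (g : MvPowerSeries (Fin 2) k), μ ≠ 0 → α ≠ 0 → β ≠ 0 →
      H n (MvPowerSeries.C μ * MvPowerSeries.subst (PlaneGerm.diagScale α β) g) → H n g := by
  intro n
  induction n with
  | zero => exact fun _ _ _ g _ _ _ _ => hH0 g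
  | succ n ih =>
    intro μ α β g hμ hα hβ hn
    obtain ⟨D, ⟨hgt, hnct, hsucc⟩, hnD⟩ := (hHs n _).1 hn
    have hg : g ≠ 0 := fun h => hgt ((hInv μ α β hμ hα hβ g).2.2 h)
    have hnc : ¬ PlaneGerm.IsNC g := fun h => hnct ((hInv μ α β hμ hα hβ g).1.2 h)
    rcases hsucc with ⟨t, ht⟩ | hv
    · obtain ⟨t', ht'⟩ := (hEquiv μ α β hμ hα hβ g).1 t
      obtain ⟨D', hD'⟩ := (hExist g hg).1 t'
      obtain ⟨μ', α', β', hμ', hα', hβ', hDeq⟩ := ht' D D' ht hD'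
      refine (hHs n g).2 ⟨D', ⟨hg, hnc, Or.inl ⟨t', hD'⟩⟩, ih μ' α' β' D' hμ' hα' hβ' ?_⟩
      rw [← hDeq]
      exact hnD
    · obtain ⟨D', hD'⟩ := (hExist g hg).2
      obtain ⟨μ', α', β', hμ', hα', hβ', hDeq⟩ := (hEquiv μ α β hμ hα hβ g).2 D D' hv hD'
      refine (hHs n g).2 ⟨D', ⟨hg, hnc, Or.inr hD'⟩, ih μ' α' β' D' hμ' hα' hβ' ?_⟩
      rw [← hDeq]
      exact hnD

end NonNCCountAssembly

/-- **Glue stub of the line `hasse-ridge-face-selection` (v12).**  The folklore toolkit of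
first-neighbourhood germs, the rescaling calculus, and the absence of infinite bad chains together give
the named fact `PlaneGermNonNCCount k` (strong embedded resolution of plane curve germs, chart form), with
`ν b :=` the length of the longest chain of bad steps from `b`. -/
theorem stub_nonNCCountAssembly : ∀ (k : Type) [Field k],
    (∀ b : MvPowerSeries (Fin 2) k, b ≠ 0 →
      (∀ t : k, ∃ D, PlaneGerm.IsTransform (PlaneGerm.dirChart t) b D) ∧
      ∃ D, PlaneGerm.IsTransform (PlaneGerm.vertChart k) b D) ∧
    (∀ (Φ : Fin 2 → MvPowerSeries (Fin 2) k) (b D D' : MvPowerSeries (Fin 2) k),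
      PlaneGerm.IsTransform Φ b D → PlaneGerm.IsTransform Φ b D' → D = D') ∧
    (∀ b D : MvPowerSeries (Fin 2) k, PlaneGerm.IsSuccessor b D → D ≠ 0) ∧
    (∀ b : MvPowerSeries (Fin 2) k, b ≠ 0 → ∃ T : Finset k, ∀ t ∉ T, ∀ D : MvPowerSeries (Fin 2) k,
      PlaneGerm.IsTransform (PlaneGerm.dirChart t) b D → PlaneGerm.IsNC D) ∧
    (∀ b d D : MvPowerSeries (Fin 2) k, d ≠ 0 → b ∣ d →
      (∀ t : k, PlaneGerm.IsTransform (PlaneGerm.dirChart t) b D →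
        ∃ D', PlaneGerm.IsTransform (PlaneGerm.dirChart t) d D' ∧ D ∣ D') ∧
      (PlaneGerm.IsTransform (PlaneGerm.vertChart k) b D →
        ∃ D', PlaneGerm.IsTransform (PlaneGerm.vertChart k) d D' ∧ D ∣ D')) ∧
    (∀ b d : MvPowerSeries (Fin 2) k, d ≠ 0 → b ∣ d → PlaneGerm.IsNC d → PlaneGerm.IsNC b) →
    (∀ (α β α' β' : k) (g : MvPowerSeries (Fin 2) k),
      MvPowerSeries.subst (PlaneGerm.diagScale α β) (MvPowerSeries.subst (PlaneGerm.diagScale α' β') g) =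
        MvPowerSeries.subst (PlaneGerm.diagScale (α' * α) (β' * β)) g) ∧
    (∀ g : MvPowerSeries (Fin 2) k, MvPowerSeries.subst (PlaneGerm.diagScale (1 : k) 1) g = g) ∧
    (∀ (α β μ : k) (g : MvPowerSeries (Fin 2) k),
      MvPowerSeries.subst (PlaneGerm.diagScale α β) (MvPowerSeries.C μ * g) =
        MvPowerSeries.C μ * MvPowerSeries.subst (PlaneGerm.diagScale α β) g) ∧
    (∀ (μ α β : k), μ ≠ 0 → α ≠ 0 → β ≠ 0 → ∀ g : MvPowerSeries (Fin 2) k,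
      (∀ t : k, ∃ t' : k, ∀ D D' : MvPowerSeries (Fin 2) k,
        PlaneGerm.IsTransform (PlaneGerm.dirChart t)
          (MvPowerSeries.C μ * MvPowerSeries.subst (PlaneGerm.diagScale α β) g) D →
        PlaneGerm.IsTransform (PlaneGerm.dirChart t') g D' →
        ∃ (μ' α' β' : k), μ' ≠ 0 ∧ α' ≠ 0 ∧ β' ≠ 0 ∧
          D = MvPowerSeries.C μ' * MvPowerSeries.subst (PlaneGerm.diagScale α' β') D') ∧
      (∀ D D' : MvPowerSeries (Fin 2) k,
        PlaneGerm.IsTransform (PlaneGerm.vertChart k)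
          (MvPowerSeries.C μ * MvPowerSeries.subst (PlaneGerm.diagScale α β) g) D →
        PlaneGerm.IsTransform (PlaneGerm.vertChart k) g D' →
        ∃ (μ' α' β' : k), μ' ≠ 0 ∧ α' ≠ 0 ∧ β' ≠ 0 ∧
          D = MvPowerSeries.C μ' * MvPowerSeries.subst (PlaneGerm.diagScale α' β') D')) ∧
    (∀ (μ α β : k), μ ≠ 0 → α ≠ 0 → β ≠ 0 → ∀ g : MvPowerSeries (Fin 2) k,
      (PlaneGerm.IsNC (MvPowerSeries.C μ * MvPowerSeries.subst (PlaneGerm.diagScale α β) g) ↔ PlaneGerm.IsNC g) ∧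
      (MvPowerSeries.C μ * MvPowerSeries.subst (PlaneGerm.diagScale α β) g = 0 ↔ g = 0)) ∧
    (∀ b : MvPowerSeries (Fin 2) k, b ≠ 0 → ∀ c : Fin 2 → k, c ≠ 0 →
      ∀ (a : ℕ) (G : MvPowerSeries (Fin 3) k),
        MvPowerSeries.subst (CobordantChart.chart (fun _ : Fin 2 => 1) c) b = MvPowerSeries.X 0 ^ a * G →
        ¬ (MvPowerSeries.X (0 : Fin 3) ∣ G) →
        ∃ i : Fin 2, c i ≠ 0 ∧ ∃ (D : MvPowerSeries (Fin 2) k) (μ α β : k), μ ≠ 0 ∧ α ≠ 0 ∧ β ≠ 0 ∧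
          PlaneGerm.IsSuccessor b D ∧
          MvPowerSeries.X 0 * MvPowerSeries.subst (fun j : Fin 3 => if j = i.succ then (0 : MvPowerSeries (Fin 2) k)
              else MvPowerSeries.X (Fin.predAbove i j)) G =
            MvPowerSeries.C μ * MvPowerSeries.subst (PlaneGerm.diagScale α β) D) →
    (∀ f : ℕ → MvPowerSeries (Fin 2) k, ∃ i, ¬ PlaneGerm.IsBadStep (f i) (f (i + 1))) →
    PlaneGermNonNCCount k := by
  intro k _ h1 h2 h3
  obtain ⟨hExist, hUniq, hNe, hFin, hDiv, hNCdown⟩ := h1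
  obtain ⟨-, -, -, hEquiv, hInv, hLit⟩ := h2
  obtain ⟨H, hH0, hHs⟩ := NonNCCountAssembly.exists_chainPred (k := k)
  obtain ⟨ν, hle, hmem⟩ := NonNCCountAssembly.exists_count H hH0
    (NonNCCountAssembly.chain_bounded H hHs hExist hUniq hFin h3)
  refine ⟨ν, ?_, ?_, ?_⟩
  · -- (i): `ν b = 0` iff the support of `b` is a normal crossing
    intro b hb
    change ν b = 0 ↔ PlaneGerm.IsNC b
    constructor
    · intro h0
      by_contra hnc
      obtain ⟨D, hD⟩ := (hExist b hb).1 0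
      have h1b : H 1 b := (hHs 0 b).2 ⟨D, ⟨hb, hnc, Or.inl ⟨0, hD⟩⟩, hH0 D⟩
      have h1le : 1 ≤ ν b := hle b 1 h1b
      omega
    · intro hnc
      exact NonNCCountAssembly.chain_eq_zero_of_not_bad H hHs (fun h => h.2 hnc) (hmem b)
  · -- (ii): monotone along divisibility
    intro b d hd hbd
    exact hle d (ν b)
      (NonNCCountAssembly.chain_of_dvd H hH0 hHs hNe hDiv hNCdown (ν b) b d hd hbd (hmem b))
  · -- (iii): strict drop at every exceptional point of the first blow-up
    intro b hb hnc c hc a G hfac hndvd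
    change ¬ PlaneGerm.IsNC b at hnc
    obtain ⟨i, hci, D, μ, α, β, hμ, hα, hβ, hsucc, hEq⟩ := hLit b hb c hc a G hfac hndvd
    refine ⟨i, hci, ?_⟩
    rw [hEq]
    have hD : H (ν (MvPowerSeries.C μ * MvPowerSeries.subst (PlaneGerm.diagScale α β) D)) D :=
      NonNCCountAssembly.chain_of_rescaled H hH0 hHs hExist hEquiv hInv _ μ α β D hμ hα hβ (hmem _)
    exact Nat.add_one_le_iff.mp (hle b _ ((hHs _ b).2 ⟨D, ⟨hb, hnc, hsucc⟩, hD⟩))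

end Summit.ResolutionOfSingularities.ResolutionOfSingularities.Theorems
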